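import Summits.BirchSwinnertonDyer.Rank1Residual.X10.CMPartnerRecords01
import Summits.BirchSwinnertonDyer.Rank1Residual.X10.CMPartnerRecords02
import Summits.BirchSwinnertonDyer.Rank1Residual.X10.CMPartnerRecords03
import Summits.BirchSwinnertonDyer.Rank1Residual.X10.CMPartnerRecords06
import Summits.BirchSwinnertonDyer.Rank1Residual.X10.CMPartnerRecords07
import Summits.BirchSwinnertonDyer.Rank1Residual.X10.CMPartnerRecords09
import Summits.BirchSwinnertonDyer.Rank1Residual.X10.CMPartnerRecords11
import Summits.BirchSwinnertonDyer.Rank1Residual.X10.CMPartnerRecords17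
import Summits.BirchSwinnertonDyer.Rank1Residual.X10.UnitRoad
import HarnessLib

/-!
# Class X10b (N2), the UNIT ROAD at `p = 3`: per-pair kernel RECORDS, part K — the 8 K-CM cells with
# trivial `3`-primary arithmetic (38720br1, 48400bl1, 85760k1, 150272a1, 296450bn1, 296450ey1, 408320k1, 462080i1): X_A3 (`MazurMainConjecture W 3`) AT THE PAIR WITHOUT
# Rubin, WITHOUT Greenberg–Vatsal and WITHOUT the `μ`-certificate `hC2` (cell `b2b-bsdres`, unit
# `b2b-bsdres-x10` = N2 class lead, gen 24)

HONEST FRAMING (run/shared/lean/b2b/bsd-rank1-residual/, verbatim in every file): the goal of the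
cell is to DELETE the COMBINATION-SHAPED residual classes of the Birch–Swinnerton-Dyer formula for
ALL analytic-rank `≤ 1` elliptic curves over `ℚ` — "full BSD formula for every rank `≤ 1` curve in
class `C`" assembled STRICTLY from published theorems — so that the rank-`≤ 1` remainder becomes
exactly the CONSTRUCTION-SHAPED classes, which are TYPED (missing-input `Prop`s), NOT attempted.
This is not "finishing BSD". Theorems only; NO definition, NO named fact; class X10b keeps its label
CONSTRUCTION-SHAPED (NEEDS X_A3); nothing is booked by this file; everything is PER PAIR.

## What (x10 GEN 24, X10-AUDIT §30; `class-closure/N2/LAMBDA-SUBPARTITION-x10g24.md`)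

These 8 cells are K-CM cells (GEN 19/23 records `mazurMainConjecture_t<E>_of_cm<A>[_kernel]`: Rubin 1991
`hRu` + Greenberg–Vatsal `hGV` + the analytic certificate `hC2` of the CM partner) which are ALSO unit
cells (analytic rank `0`, `a₃ ≢ 1 (mod 3)`, `3 ∤ ∏ c_ℓ`, `3 ∤ #Ш_an` in Cremona's table). For them the
UNIT road (`UnitRoad.mazurMainConjecture_three_of_ainvs_of_trivialArithmetic`: Kato 2004 Thm. 17.4 (1)
`hkato`, Greenberg 1999 Thm. 4.1 `hGr`, the period unit `h5`/`h3`; census `htam`, `hL`, `hSel`) reaches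
the same X_A3 at the pair with NO CM partner, NO Rubin, NO Greenberg–Vatsal and NO `μ`-certificate. The
kernel numerals `#Ẽ(𝔽₃)`, `#Ẽ(𝔽_ℓ)` are GEN 19's (`CMPartnerRecords.card_t<E>_3`, `card_t<E>_ℓ`), consumed
BY NAME (no duplicate). With parts A–J (69 cells outside K-CM) every one of the 77 N2 unit cells now carries
a unit-road record. Per pair; class statement untouched; nothing booked.

References: K. Kato, Astérisque 295 (2004) Thm. 17.4 (1) [Kato2004Asterisque]; R. Greenberg, LNM 1716
(1999) Thm. 4.1, Prop. 3.8 [GreenbergLNM1716]; B. Mazur, Invent. Math. 44 (1978) Prop. 6.3 (1) [Mazur1978];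
J. E. Cremona, tables [Cremona2006].
-/

set_option autoImplicit false

noncomputable section

open scoped Classical MatrixGroups ModularForm

open CongruenceSubgroup WeierstrassCurve Literature.NumberTheory.EllipticCurves
  Literature.NumberTheory.EllipticCurves.ModularForms Literature.NumberTheory.EllipticCurves.Rank1Residual
  Literature.NumberTheory.EllipticCurves.Rank1Residual.X11RankOneCertificates
  Summit.BirchSwinnertonDyer.BirchSwinnertonDyer.Rank1Residual.IntModel
  Summit.BirchSwinnertonDyer.BirchSwinnertonDyer.Rank1Residual.X11RankOne
  Summit.BirchSwinnertonDyer.BirchSwinnertonDyer.Theorems.Rank1ResidualX1Defs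

namespace Summit.BirchSwinnertonDyer.Rank1Residual.X10.UnitRoad

open Summit.BirchSwinnertonDyer.Rank1Residual.X10.CMPartnerRecords

/-! ### `38720br1` (3Ns, N = 38720, K-CM partner class `7744s`) -/

/-- **X_A3 AT THE PAIR `(38720br1, 3)` by the UNIT ROAD — a K-CM cell, here WITHOUT Rubin / Greenberg–Vatsal / `hC2`:
`MazurMainConjecture W 3`.** Cremona model `[0, -1, 0, -1510241, 776315905]`, `N = 38720 = 2^6 · 5 · 11^2`; census image `3Ns`, K-CM partner class
`7744s`; `#Ẽ(𝔽₃) = 5`, `a₃ = -1` (good ORDINARY, NON-ANOMALOUS); Frobenius witness `ℓ = 7`: `#Ẽ(𝔽_{7}) = 11`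
(GEN 19 numerals `card_t38720br1_3`, `card_t38720br1_7` of `CMPartnerRecords01`, BY NAME). Cremona `allbsd`: analytic rank `0`, `#E(ℚ)_tors = 1`,
`∏ c_ℓ = 4`, `#Ш_an = 1`. Displayed binders: PUBLISHED `hkato`, `hGr`, `h5`, `h3`; census `htam`, `hL`, `hSel`.
Per pair; class statement untouched; nothing booked. [cite: Kato2004Asterisque, Thm. 17.4 (1) (p. 273)]
[cite: GreenbergLNM1716, Thm. 4.1 (p. 102) and Prop. 3.8 (p. 95)] [cite: Mazur1978, §6 Prop. 6.3 (1) (p. 153)]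
[cite: Cremona2006, Table 1 (Cremona label 38720br1)] -/
theorem mazurMainConjecture_unit_u38720br1
    (hkato : ∀ (W : WeierstrassCurve ℚ) [W.IsElliptic] [W.IsGloballyMinimal] (p : ℕ) [Fact p.Prime]
      (κ : ZpExtension ℚ p) (γ : Field.absoluteGaloisGroup ℚ) (N : ℕ) [NeZero N]
      (f : CuspForm (Gamma0 N) 2), kato_divisibility W p (κ := κ) (γ := γ) (f := f))
    (hGr : greenberg_charValue_rankZero) (h5 : realPeriodRat_eq_unit_mul_plusPeriod)
    (h3 : realPeriodRat_eq_unit_mul_plusPeriod_three)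
    (W : WeierstrassCurve ℚ) [W.IsElliptic] [W.IsGloballyMinimal] [Fact (Nat.Prime 3)]
    (hI : integralModelInt W = ⟨0, (-1), 0, (-1510241), 776315905⟩)
    (htam : ¬ 3 ∣ W.tamagawaProduct)
    (hL : ∃ q : ℚ, q ≠ 0 ∧ W.entireLFunction 1 / (W.realPeriodRat : ℂ) = (q : ℂ) ∧ padicValRat 3 q = 0)
    (hSel : Nat.card (W.selmerGroupPInfty 3) = 1) :
    MazurMainConjecture W 3 :=
  haveI : Fact (Nat.Prime 7) := ⟨by norm_num⟩
  mazurMainConjecture_three_of_ainvs_of_trivialArithmetic hkato hGr h5 h3 0 (-1) 0 (-1510241) 776315905 hI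
    7 11 5 (by decide +kernel) card_t38720br1_3 (by decide) (by decide) (by decide) (by decide +kernel)
    card_t38720br1_7 (by decide +kernel) htam hL hSel

/-! ### `48400bl1` (3Ns, N = 48400, K-CM partner class `48400bk`) -/

/-- **X_A3 AT THE PAIR `(48400bl1, 3)` by the UNIT ROAD — a K-CM cell, here WITHOUT Rubin / Greenberg–Vatsal / `hC2`:
`MazurMainConjecture W 3`.** Cremona model `[0, -1, 0, -9439008, 12125216512]`, `N = 48400 = 2^4 · 5^2 · 11^2`; census image `3Ns`, K-CM partner class
`48400bk`; `#Ẽ(𝔽₃) = 5`, `a₃ = -1` (good ORDINARY, NON-ANOMALOUS); Frobenius witness `ℓ = 7`: `#Ẽ(𝔽_{7}) = 5`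
(GEN 19 numerals `card_t48400bl1_3`, `card_t48400bl1_7` of `CMPartnerRecords17`, BY NAME). Cremona `allbsd`: analytic rank `0`, `#E(ℚ)_tors = 1`,
`∏ c_ℓ = 16`, `#Ш_an = 1`. Displayed binders: PUBLISHED `hkato`, `hGr`, `h5`, `h3`; census `htam`, `hL`, `hSel`.
Per pair; class statement untouched; nothing booked. [cite: Kato2004Asterisque, Thm. 17.4 (1) (p. 273)]
[cite: GreenbergLNM1716, Thm. 4.1 (p. 102) and Prop. 3.8 (p. 95)] [cite: Mazur1978, §6 Prop. 6.3 (1) (p. 153)]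
[cite: Cremona2006, Table 1 (Cremona label 48400bl1)] -/
theorem mazurMainConjecture_unit_u48400bl1
    (hkato : ∀ (W : WeierstrassCurve ℚ) [W.IsElliptic] [W.IsGloballyMinimal] (p : ℕ) [Fact p.Prime]
      (κ : ZpExtension ℚ p) (γ : Field.absoluteGaloisGroup ℚ) (N : ℕ) [NeZero N]
      (f : CuspForm (Gamma0 N) 2), kato_divisibility W p (κ := κ) (γ := γ) (f := f))
    (hGr : greenberg_charValue_rankZero) (h5 : realPeriodRat_eq_unit_mul_plusPeriod)
    (h3 : realPeriodRat_eq_unit_mul_plusPeriod_three)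
    (W : WeierstrassCurve ℚ) [W.IsElliptic] [W.IsGloballyMinimal] [Fact (Nat.Prime 3)]
    (hI : integralModelInt W = ⟨0, (-1), 0, (-9439008), 12125216512⟩)
    (htam : ¬ 3 ∣ W.tamagawaProduct)
    (hL : ∃ q : ℚ, q ≠ 0 ∧ W.entireLFunction 1 / (W.realPeriodRat : ℂ) = (q : ℂ) ∧ padicValRat 3 q = 0)
    (hSel : Nat.card (W.selmerGroupPInfty 3) = 1) :
    MazurMainConjecture W 3 :=
  haveI : Fact (Nat.Prime 7) := ⟨by norm_num⟩
  mazurMainConjecture_three_of_ainvs_of_trivialArithmetic hkato hGr h5 h3 0 (-1) 0 (-9439008) 12125216512 hI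
    7 5 5 (by decide +kernel) card_t48400bl1_3 (by decide) (by decide) (by decide) (by decide +kernel)
    card_t48400bl1_7 (by decide +kernel) htam hL hSel

/-! ### `85760k1` (3Ns, N = 85760, K-CM partner class `256d`) -/

/-- **X_A3 AT THE PAIR `(85760k1, 3)` by the UNIT ROAD — a K-CM cell, here WITHOUT Rubin / Greenberg–Vatsal / `hC2`:
`MazurMainConjecture W 3`.** Cremona model `[0, -1, 0, -25971, 1822895]`, `N = 85760 = 2^8 · 5 · 67`; census image `3Ns`, K-CM partner class
`256d`; `#Ẽ(𝔽₃) = 2`, `a₃ = 2` (good ORDINARY, NON-ANOMALOUS); Frobenius witness `ℓ = 7`: `#Ẽ(𝔽_{7}) = 5`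
(GEN 19 numerals `card_t85760k1_3`, `card_t85760k1_7` of `CMPartnerRecords02`, BY NAME). Cremona `allbsd`: analytic rank `0`, `#E(ℚ)_tors = 1`,
`∏ c_ℓ = 2`, `#Ш_an = 1`. Displayed binders: PUBLISHED `hkato`, `hGr`, `h5`, `h3`; census `htam`, `hL`, `hSel`.
Per pair; class statement untouched; nothing booked. [cite: Kato2004Asterisque, Thm. 17.4 (1) (p. 273)]
[cite: GreenbergLNM1716, Thm. 4.1 (p. 102) and Prop. 3.8 (p. 95)] [cite: Mazur1978, §6 Prop. 6.3 (1) (p. 153)]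
[cite: Cremona2006, Table 1 (Cremona label 85760k1)] -/
theorem mazurMainConjecture_unit_u85760k1
    (hkato : ∀ (W : WeierstrassCurve ℚ) [W.IsElliptic] [W.IsGloballyMinimal] (p : ℕ) [Fact p.Prime]
      (κ : ZpExtension ℚ p) (γ : Field.absoluteGaloisGroup ℚ) (N : ℕ) [NeZero N]
      (f : CuspForm (Gamma0 N) 2), kato_divisibility W p (κ := κ) (γ := γ) (f := f))
    (hGr : greenberg_charValue_rankZero) (h5 : realPeriodRat_eq_unit_mul_plusPeriod)
    (h3 : realPeriodRat_eq_unit_mul_plusPeriod_three)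
    (W : WeierstrassCurve ℚ) [W.IsElliptic] [W.IsGloballyMinimal] [Fact (Nat.Prime 3)]
    (hI : integralModelInt W = ⟨0, (-1), 0, (-25971), 1822895⟩)
    (htam : ¬ 3 ∣ W.tamagawaProduct)
    (hL : ∃ q : ℚ, q ≠ 0 ∧ W.entireLFunction 1 / (W.realPeriodRat : ℂ) = (q : ℂ) ∧ padicValRat 3 q = 0)
    (hSel : Nat.card (W.selmerGroupPInfty 3) = 1) :
    MazurMainConjecture W 3 :=
  haveI : Fact (Nat.Prime 7) := ⟨by norm_num⟩
  mazurMainConjecture_three_of_ainvs_of_trivialArithmetic hkato hGr h5 h3 0 (-1) 0 (-25971) 1822895 hI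
    7 5 2 (by decide +kernel) card_t85760k1_3 (by decide) (by decide) (by decide) (by decide +kernel)
    card_t85760k1_7 (by decide +kernel) htam hL hSel

/-! ### `150272a1` (3Ns, N = 150272, K-CM partner class `256d`) -/

/-- **X_A3 AT THE PAIR `(150272a1, 3)` by the UNIT ROAD — a K-CM cell, here WITHOUT Rubin / Greenberg–Vatsal / `hC2`:
`MazurMainConjecture W 3`.** Cremona model `[0, -1, 0, -1551147, 744097031]`, `N = 150272 = 2^8 · 587`; census image `3Ns`, K-CM partner class
`256d`; `#Ẽ(𝔽₃) = 2`, `a₃ = 2` (good ORDINARY, NON-ANOMALOUS); Frobenius witness `ℓ = 7`: `#Ẽ(𝔽_{7}) = 8`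
(GEN 19 numerals `card_t150272a1_3`, `card_t150272a1_7` of `CMPartnerRecords03`, BY NAME). Cremona `allbsd`: analytic rank `0`, `#E(ℚ)_tors = 1`,
`∏ c_ℓ = 2`, `#Ш_an = 1`. Displayed binders: PUBLISHED `hkato`, `hGr`, `h5`, `h3`; census `htam`, `hL`, `hSel`.
Per pair; class statement untouched; nothing booked. [cite: Kato2004Asterisque, Thm. 17.4 (1) (p. 273)]
[cite: GreenbergLNM1716, Thm. 4.1 (p. 102) and Prop. 3.8 (p. 95)] [cite: Mazur1978, §6 Prop. 6.3 (1) (p. 153)]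
[cite: Cremona2006, Table 1 (Cremona label 150272a1)] -/
theorem mazurMainConjecture_unit_u150272a1
    (hkato : ∀ (W : WeierstrassCurve ℚ) [W.IsElliptic] [W.IsGloballyMinimal] (p : ℕ) [Fact p.Prime]
      (κ : ZpExtension ℚ p) (γ : Field.absoluteGaloisGroup ℚ) (N : ℕ) [NeZero N]
      (f : CuspForm (Gamma0 N) 2), kato_divisibility W p (κ := κ) (γ := γ) (f := f))
    (hGr : greenberg_charValue_rankZero) (h5 : realPeriodRat_eq_unit_mul_plusPeriod)
    (h3 : realPeriodRat_eq_unit_mul_plusPeriod_three)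
    (W : WeierstrassCurve ℚ) [W.IsElliptic] [W.IsGloballyMinimal] [Fact (Nat.Prime 3)]
    (hI : integralModelInt W = ⟨0, (-1), 0, (-1551147), 744097031⟩)
    (htam : ¬ 3 ∣ W.tamagawaProduct)
    (hL : ∃ q : ℚ, q ≠ 0 ∧ W.entireLFunction 1 / (W.realPeriodRat : ℂ) = (q : ℂ) ∧ padicValRat 3 q = 0)
    (hSel : Nat.card (W.selmerGroupPInfty 3) = 1) :
    MazurMainConjecture W 3 :=
  haveI : Fact (Nat.Prime 7) := ⟨by norm_num⟩
  mazurMainConjecture_three_of_ainvs_of_trivialArithmetic hkato hGr h5 h3 0 (-1) 0 (-1551147) 744097031 hI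
    7 8 2 (by decide +kernel) card_t150272a1_3 (by decide) (by decide) (by decide) (by decide +kernel)
    card_t150272a1_7 (by decide +kernel) htam hL hSel

/-! ### `296450bn1` (3Ns, N = 296450, K-CM partner class `148225bj`) -/

/-- **X_A3 AT THE PAIR `(296450bn1, 3)` by the UNIT ROAD — a K-CM cell, here WITHOUT Rubin / Greenberg–Vatsal / `hC2`:
`MazurMainConjecture W 3`.** Cremona model `[1, 1, 0, -238900, -48910000]`, `N = 296450 = 2 · 5^2 · 7^2 · 11^2`; census image `3Ns`, K-CM partner class
`148225bj`; `#Ẽ(𝔽₃) = 5`, `a₃ = -1` (good ORDINARY, NON-ANOMALOUS); Frobenius witness `ℓ = 13`: `#Ẽ(𝔽_{13}) = 14`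
(GEN 19 numerals `card_t296450bn1_3`, `card_t296450bn1_13` of `CMPartnerRecords06`, BY NAME). Cremona `allbsd`: analytic rank `0`, `#E(ℚ)_tors = 1`,
`∏ c_ℓ = 8`, `#Ш_an = 1`. Displayed binders: PUBLISHED `hkato`, `hGr`, `h5`, `h3`; census `htam`, `hL`, `hSel`.
Per pair; class statement untouched; nothing booked. [cite: Kato2004Asterisque, Thm. 17.4 (1) (p. 273)]
[cite: GreenbergLNM1716, Thm. 4.1 (p. 102) and Prop. 3.8 (p. 95)] [cite: Mazur1978, §6 Prop. 6.3 (1) (p. 153)]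
[cite: Cremona2006, Table 1 (Cremona label 296450bn1)] -/
theorem mazurMainConjecture_unit_u296450bn1
    (hkato : ∀ (W : WeierstrassCurve ℚ) [W.IsElliptic] [W.IsGloballyMinimal] (p : ℕ) [Fact p.Prime]
      (κ : ZpExtension ℚ p) (γ : Field.absoluteGaloisGroup ℚ) (N : ℕ) [NeZero N]
      (f : CuspForm (Gamma0 N) 2), kato_divisibility W p (κ := κ) (γ := γ) (f := f))
    (hGr : greenberg_charValue_rankZero) (h5 : realPeriodRat_eq_unit_mul_plusPeriod)
    (h3 : realPeriodRat_eq_unit_mul_plusPeriod_three)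
    (W : WeierstrassCurve ℚ) [W.IsElliptic] [W.IsGloballyMinimal] [Fact (Nat.Prime 3)]
    (hI : integralModelInt W = ⟨1, 1, 0, (-238900), (-48910000)⟩)
    (htam : ¬ 3 ∣ W.tamagawaProduct)
    (hL : ∃ q : ℚ, q ≠ 0 ∧ W.entireLFunction 1 / (W.realPeriodRat : ℂ) = (q : ℂ) ∧ padicValRat 3 q = 0)
    (hSel : Nat.card (W.selmerGroupPInfty 3) = 1) :
    MazurMainConjecture W 3 :=
  haveI : Fact (Nat.Prime 13) := ⟨by norm_num⟩
  mazurMainConjecture_three_of_ainvs_of_trivialArithmetic hkato hGr h5 h3 1 1 0 (-238900) (-48910000) hI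
    13 14 5 (by decide +kernel) card_t296450bn1_3 (by decide) (by decide) (by decide) (by decide +kernel)
    card_t296450bn1_13 (by decide +kernel) htam hL hSel

/-! ### `296450ey1` (3Ns, N = 296450, K-CM partner class `148225bj`) -/

/-- **X_A3 AT THE PAIR `(296450ey1, 3)` by the UNIT ROAD — a K-CM cell, here WITHOUT Rubin / Greenberg–Vatsal / `hC2`:
`MazurMainConjecture W 3`.** Cremona model `[1, 1, 0, -252375, 72567125]`, `N = 296450 = 2 · 5^2 · 7^2 · 11^2`; census image `3Ns`, K-CM partner class
`148225bj`; `#Ẽ(𝔽₃) = 2`, `a₃ = 2` (good ORDINARY, NON-ANOMALOUS); Frobenius witness `ℓ = 13`: `#Ẽ(𝔽_{13}) = 8`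
(GEN 19 numerals `card_t296450ey1_3`, `card_t296450ey1_13` of `CMPartnerRecords07`, BY NAME). Cremona `allbsd`: analytic rank `0`, `#E(ℚ)_tors = 2`,
`∏ c_ℓ = 64`, `#Ш_an = 1`. Displayed binders: PUBLISHED `hkato`, `hGr`, `h5`, `h3`; census `htam`, `hL`, `hSel`.
Per pair; class statement untouched; nothing booked. [cite: Kato2004Asterisque, Thm. 17.4 (1) (p. 273)]
[cite: GreenbergLNM1716, Thm. 4.1 (p. 102) and Prop. 3.8 (p. 95)] [cite: Mazur1978, §6 Prop. 6.3 (1) (p. 153)]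
[cite: Cremona2006, Table 1 (Cremona label 296450ey1)] -/
theorem mazurMainConjecture_unit_u296450ey1
    (hkato : ∀ (W : WeierstrassCurve ℚ) [W.IsElliptic] [W.IsGloballyMinimal] (p : ℕ) [Fact p.Prime]
      (κ : ZpExtension ℚ p) (γ : Field.absoluteGaloisGroup ℚ) (N : ℕ) [NeZero N]
      (f : CuspForm (Gamma0 N) 2), kato_divisibility W p (κ := κ) (γ := γ) (f := f))
    (hGr : greenberg_charValue_rankZero) (h5 : realPeriodRat_eq_unit_mul_plusPeriod)
    (h3 : realPeriodRat_eq_unit_mul_plusPeriod_three)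
    (W : WeierstrassCurve ℚ) [W.IsElliptic] [W.IsGloballyMinimal] [Fact (Nat.Prime 3)]
    (hI : integralModelInt W = ⟨1, 1, 0, (-252375), 72567125⟩)
    (htam : ¬ 3 ∣ W.tamagawaProduct)
    (hL : ∃ q : ℚ, q ≠ 0 ∧ W.entireLFunction 1 / (W.realPeriodRat : ℂ) = (q : ℂ) ∧ padicValRat 3 q = 0)
    (hSel : Nat.card (W.selmerGroupPInfty 3) = 1) :
    MazurMainConjecture W 3 :=
  haveI : Fact (Nat.Prime 13) := ⟨by norm_num⟩
  mazurMainConjecture_three_of_ainvs_of_trivialArithmetic hkato hGr h5 h3 1 1 0 (-252375) 72567125 hI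
    13 8 2 (by decide +kernel) card_t296450ey1_3 (by decide) (by decide) (by decide) (by decide +kernel)
    card_t296450ey1_13 (by decide +kernel) htam hL hSel

/-! ### `408320k1` (3Ns, N = 408320, K-CM partner class `256d`) -/

/-- **X_A3 AT THE PAIR `(408320k1, 3)` by the UNIT ROAD — a K-CM cell, here WITHOUT Rubin / Greenberg–Vatsal / `hC2`:
`MazurMainConjecture W 3`.** Cremona model `[0, -1, 0, 5459, 530805]`, `N = 408320 = 2^8 · 5 · 11 · 29`; census image `3Ns`, K-CM partner class
`256d`; `#Ẽ(𝔽₃) = 2`, `a₃ = 2` (good ORDINARY, NON-ANOMALOUS); Frobenius witness `ℓ = 7`: `#Ẽ(𝔽_{7}) = 11`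
(GEN 19 numerals `card_t408320k1_3`, `card_t408320k1_7` of `CMPartnerRecords09`, BY NAME). Cremona `allbsd`: analytic rank `0`, `#E(ℚ)_tors = 1`,
`∏ c_ℓ = 2`, `#Ш_an = 1`. Displayed binders: PUBLISHED `hkato`, `hGr`, `h5`, `h3`; census `htam`, `hL`, `hSel`.
Per pair; class statement untouched; nothing booked. [cite: Kato2004Asterisque, Thm. 17.4 (1) (p. 273)]
[cite: GreenbergLNM1716, Thm. 4.1 (p. 102) and Prop. 3.8 (p. 95)] [cite: Mazur1978, §6 Prop. 6.3 (1) (p. 153)]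
[cite: Cremona2006, Table 1 (Cremona label 408320k1)] -/
theorem mazurMainConjecture_unit_u408320k1
    (hkato : ∀ (W : WeierstrassCurve ℚ) [W.IsElliptic] [W.IsGloballyMinimal] (p : ℕ) [Fact p.Prime]
      (κ : ZpExtension ℚ p) (γ : Field.absoluteGaloisGroup ℚ) (N : ℕ) [NeZero N]
      (f : CuspForm (Gamma0 N) 2), kato_divisibility W p (κ := κ) (γ := γ) (f := f))
    (hGr : greenberg_charValue_rankZero) (h5 : realPeriodRat_eq_unit_mul_plusPeriod)
    (h3 : realPeriodRat_eq_unit_mul_plusPeriod_three)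
    (W : WeierstrassCurve ℚ) [W.IsElliptic] [W.IsGloballyMinimal] [Fact (Nat.Prime 3)]
    (hI : integralModelInt W = ⟨0, (-1), 0, 5459, 530805⟩)
    (htam : ¬ 3 ∣ W.tamagawaProduct)
    (hL : ∃ q : ℚ, q ≠ 0 ∧ W.entireLFunction 1 / (W.realPeriodRat : ℂ) = (q : ℂ) ∧ padicValRat 3 q = 0)
    (hSel : Nat.card (W.selmerGroupPInfty 3) = 1) :
    MazurMainConjecture W 3 :=
  haveI : Fact (Nat.Prime 7) := ⟨by norm_num⟩
  mazurMainConjecture_three_of_ainvs_of_trivialArithmetic hkato hGr h5 h3 0 (-1) 0 5459 530805 hI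
    7 11 2 (by decide +kernel) card_t408320k1_3 (by decide) (by decide) (by decide) (by decide +kernel)
    card_t408320k1_7 (by decide +kernel) htam hL hSel

/-! ### `462080i1` (3Ns, N = 462080, K-CM partner class `92416v`) -/

/-- **X_A3 AT THE PAIR `(462080i1, 3)` by the UNIT ROAD — a K-CM cell, here WITHOUT Rubin / Greenberg–Vatsal / `hC2`:
`MazurMainConjecture W 3`.** Cremona model `[0, -1, 0, -2881261, -1980463435]`, `N = 462080 = 2^8 · 5 · 19^2`; census image `3Ns`, K-CM partner class
`92416v`; `#Ẽ(𝔽₃) = 5`, `a₃ = -1` (good ORDINARY, NON-ANOMALOUS); Frobenius witness `ℓ = 7`: `#Ẽ(𝔽_{7}) = 11`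
(GEN 19 numerals `card_t462080i1_3`, `card_t462080i1_7` of `CMPartnerRecords11`, BY NAME). Cremona `allbsd`: analytic rank `0`, `#E(ℚ)_tors = 1`,
`∏ c_ℓ = 8`, `#Ш_an = 4`. Displayed binders: PUBLISHED `hkato`, `hGr`, `h5`, `h3`; census `htam`, `hL`, `hSel`.
Per pair; class statement untouched; nothing booked. [cite: Kato2004Asterisque, Thm. 17.4 (1) (p. 273)]
[cite: GreenbergLNM1716, Thm. 4.1 (p. 102) and Prop. 3.8 (p. 95)] [cite: Mazur1978, §6 Prop. 6.3 (1) (p. 153)]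
[cite: Cremona2006, Table 1 (Cremona label 462080i1)] -/
theorem mazurMainConjecture_unit_u462080i1
    (hkato : ∀ (W : WeierstrassCurve ℚ) [W.IsElliptic] [W.IsGloballyMinimal] (p : ℕ) [Fact p.Prime]
      (κ : ZpExtension ℚ p) (γ : Field.absoluteGaloisGroup ℚ) (N : ℕ) [NeZero N]
      (f : CuspForm (Gamma0 N) 2), kato_divisibility W p (κ := κ) (γ := γ) (f := f))
    (hGr : greenberg_charValue_rankZero) (h5 : realPeriodRat_eq_unit_mul_plusPeriod)
    (h3 : realPeriodRat_eq_unit_mul_plusPeriod_three)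
    (W : WeierstrassCurve ℚ) [W.IsElliptic] [W.IsGloballyMinimal] [Fact (Nat.Prime 3)]
    (hI : integralModelInt W = ⟨0, (-1), 0, (-2881261), (-1980463435)⟩)
    (htam : ¬ 3 ∣ W.tamagawaProduct)
    (hL : ∃ q : ℚ, q ≠ 0 ∧ W.entireLFunction 1 / (W.realPeriodRat : ℂ) = (q : ℂ) ∧ padicValRat 3 q = 0)
    (hSel : Nat.card (W.selmerGroupPInfty 3) = 1) :
    MazurMainConjecture W 3 :=
  haveI : Fact (Nat.Prime 7) := ⟨by norm_num⟩
  mazurMainConjecture_three_of_ainvs_of_trivialArithmetic hkato hGr h5 h3 0 (-1) 0 (-2881261) (-1980463435) hI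
    7 11 5 (by decide +kernel) card_t462080i1_3 (by decide) (by decide) (by decide) (by decide +kernel)
    card_t462080i1_7 (by decide +kernel) htam hL hSel

end Summit.BirchSwinnertonDyer.Rank1Residual.X10.UnitRoad
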